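import Summits.ResolutionOfSingularities.ResolutionOfSingularities.Theorems.MaxContactCutCompanionCut
import Summits.ResolutionOfSingularities.ResolutionOfSingularities.Theorems.DepthCutCells
import HarnessLib

/-!
# MaxContactCutDepthCut — decomp-res node «AntelopeCut» (lens-4 g27, critic row 157), tree file 5/5 of the node

Content VERBATIM from the decomp-res lens-4 g27 node `HOME/decomp-res-lens-4/g27/AntelopeCut.lean` (pin de2834f0 =
`parts/AntelopeCut-g27-de2834f0.lean`,
1 885 l; HOME = run/shared/lean/pub/decomp-res): its NEW PART ONLY, §71–§73 = `parts/part_new-g27-7bf105d9.lean` (40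
declarations) — the carried block
l. 106–1279 (= g26/CompanionCut.lean ll. 85–1258 VERBATIM, machine diff empty) is ALREADY in the tree as
`Theorems/CompanionAlgebra` · `CompanionHasse` ·
`CompanionPresentation` · `CompanionTransport` · `CompanionTowers` · `CompanionCutCells` ·
`MaxContactCutCompanionCut` and is imported, not repeated.
Critic: CRITIC-LEDGER row 157 (2026-08-31T00:29:39Z): DECIDED 0 · MAP 0 — BOOKED («true kernel bricks — land as
support»; the depth / height /
dimension-count axis was priced once at row 151).  Landing orders INBOX :558/:560 (lens-4 g27 landing note +
erratum, split per NEXT-g28 §4) and :566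
(critic): `--kind proof --supports stmt-ResolutionOfSingularities-28338`, namespace `…Theorems.HugValuationCut`,
canonical headers; files of the node:
`DepthLawAlgebra` · `DepthLaw` (§71 + §71b) · `AntelopeDictionary` (§72) · `DepthCutCells` (§73, cone-free cells) ·
`MaxContactCutDepthCut` (the four §73 corollaries GIVEN
31571 `MaxContactCut.NoContactHuggingTowers` BY NAME — in the Theses cone).  Aside bookkeeping (row 157 / INBOX
:566): ONE successor aside on the lens-4
column, `NoWildShallowCompanionKangarooTowers` (home `DepthCutCells`), SUPERSEDING g26's
`NoWildCompanionKangarooTowers` / g25's route aside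
`HCNoWildKangarooOffDoublePointTowers` (exact hyp-free `noWildCompanionKangarooTowers_iff_g27`); the decided cell
`NoWildDeepCompanionKangarooTowers` is a
THEOREM (`noWildDeepCompanionKangarooTowers_holds`) and is not filed; `HeightLaw.no_doublePointTower` stays.

## This file

THE FOUR §73 COROLLARIES GIVEN 31571 `MaxContactCut.NoContactHuggingTowers` BY NAME (in the Theses cone):
`noWildKangarooOffDoublePointTowers_iff_g27 (h71)` · `noWildKangarooOffLocusTowers_iff_g27 (h71)` ·
`noWildPPowerOffLocusTowers_iff_g27 (h71)` · `noWildContactFreeOffLocusTowers_iff_g27 (h71)` — TREE ASIDE 28338 /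
the g25 / g26 residuals ⟺ the g27 residual pair, through `MaxContactCutCompanionCut`'s
`noWildKangarooOffDoublePointTowers_iff_companion` / `…_iff_g26` and the hypothesis-free
`noWildCompanionKangarooTowers_iff_g27`.  Imports `MaxContactCutCompanionCut` + `DepthCutCells`; 0 sorry.

[WRITER NOTE (decomp-res writer g9): file split only (tree files ≤ 400 lines); namespace, universe, sections,
section variables and every declaration
exactly as in the lens (the node's global `set_option` and the `open …Theses` line live only in the wiring file).]

(Sources: Hauser2010Kangaroo (arXiv:0811.4151 §C); Moh1987; HauserPerlega2019 §1; Hauser2024 PRIMS 60 pp. 788, 798;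
Cossart2011 III.2 (doi:10.4310/ajm.2011.v15.n3.a3); CossartPiltant2008 §2; CossartPiltant2019 Prop. 2.50;
Giraud1975; Hironaka1970Additive.)
-/

noncomputable section

open CategoryTheory AlgebraicGeometry IsLocalRing
open Literature.AlgebraicGeometry.Resolution
open Summit.ResolutionOfSingularities.ResolutionOfSingularities.Theses
open Summit.ResolutionOfSingularities.ResolutionOfSingularities.Theorems
open WeakOrderReduction ForcedTowerClasses DivergentTowerClasses MonomialTowerClasses
open HugDimensionClasses HugDimensionKernels SurfaceShadowClasses SurfaceShadowKernels
open NearPointCut (SingularClass)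
open AbsoluteContactClasses (IsAbsContactAt SepResidueAt diffIdeal_restrict_le stalkMap_comp_toStalk_eq_stalkHom)
open scoped BigOperators

namespace Summit.ResolutionOfSingularities.ResolutionOfSingularities.Theorems.HugValuationCut

section DepthCells

/-- **GIVEN 31571 BY NAME: the g25 residual ⟺ the shallow residual** (g26's `noWildKangarooOffDoublePointTowers_iff_companion` +
g27, the g27 step hypothesis-free). [folklore] -/
theorem noWildKangarooOffDoublePointTowers_iff_g27 (h71 : MaxContactCut.NoContactHuggingTowers) :
    NoWildKangarooOffDoublePointTowers ↔ NoWildShallowCompanionKangarooTowers := by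
  rw [noWildKangarooOffDoublePointTowers_iff_companion h71, noWildCompanionKangarooTowers_iff_g27]

/-- **GIVEN 31571 BY NAME: g24's kangaroo residual ⟺ the shallow residual.** [folklore] -/
theorem noWildKangarooOffLocusTowers_iff_g27 (h71 : MaxContactCut.NoContactHuggingTowers) :
    NoWildKangarooOffLocusTowers ↔ NoWildShallowCompanionKangarooTowers := by
  rw [noWildKangarooOffLocusTowers_iff_g26 h71, noWildCompanionKangarooTowers_iff_g27]

/-- **GIVEN 31571 BY NAME: g23's `p`-power residual ⟺ the shallow residual.** [folklore] -/
theorem noWildPPowerOffLocusTowers_iff_g27 (h71 : MaxContactCut.NoContactHuggingTowers) :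
    NoWildPPowerOffLocusTowers ↔ NoWildShallowCompanionKangarooTowers := by
  rw [noWildPPowerOffLocusTowers_iff_g26 h71, noWildCompanionKangarooTowers_iff_g27]

/-- **GIVEN 31571 BY NAME, THE TREE ASIDE 28338 ⟺ THE g27 RESIDUAL** — `NoWildContactFreeOffLocusTowers` ⟺ the shallow
companion-recurrent residual. [folklore] -/
theorem noWildContactFreeOffLocusTowers_iff_g27 (h71 : MaxContactCut.NoContactHuggingTowers) :
    NoWildContactFreeOffLocusTowers ↔ NoWildShallowCompanionKangarooTowers := by
  rw [noWildContactFreeOffLocusTowers_iff_g26 h71, noWildCompanionKangarooTowers_iff_g27]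

end DepthCells

end Summit.ResolutionOfSingularities.ResolutionOfSingularities.Theorems.HugValuationCut
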